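import Literature.NumberTheory.GaloisRepresentations.TateSpinLiftContinuousProofs
import Mathlib.LinearAlgebra.SymplecticGroup
import HarnessLib

/-!
# Symplectic similitudes of multiplier `−1` that are involutions exchanging two complementary Lagrangians:
# the normal form `(0 D; D⁻¹ 0)`, `D` diagonal (Goresky–Tai 2017, Lemma 46)

Goresky–Tai, *Real structures on ordinary abelian varieties*, arXiv:1701.07742, Appendix §19.3 p0044, print (verbatim):

> «**Lemma 46.** Let `K` be a field of characteristic not equal to 2.  Let `V` be `K`-vector space of dimension `2n`.
> Let `𝔅 : V × V → R` be a nondegenerate symplectic form.  Let `τ ∈ GSp(V, 𝔅)` be an involution with multiplier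
> `−1`.  Suppose `V = V′ ⊕ V″` is a decomposition into Lagrangian subspaces that are exchanged by `τ`.  Then there
> exists a numbers `a_1, ⋯, a_n ∈ K^×` and there exists a symplectic basis `{e′_1, ⋯, e′_n, e″_1, ⋯, e″_n}` of `V`
> so that `{e′_1, ⋯, e′_n}` form a basis of `V′`, so that `{e″_1, ⋯, e″_n}` form a basis of `V″`, and so that
> `τ(e′_i) = a_ie″_i`.»
> «*Proof.* Any choice of basis `{u′_1, ⋯, u′_n}` of `V′` determines a dual basis `{u″_1, ⋯, u″_n}` of `V″` with
> respect to the nondegenerate pairing `V′ × V″ → K` defined by `𝔅`. … The matrix of `τ` with respect to this basis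
> is therefore `(0 A; ᵗA⁻¹ 0)`.  The condition `τ² = I` implies that `A` is symmetric.  Let `g = (B 0; 0 ᵗB⁻¹)` be a
> symplectic change of basis that preserves the decomposition `Kⁿ ⊕ Kⁿ`.  This has the effect of changing the matrix
> of `τ` by replacing `A` with `BAᵗB`.  Thus, it is possible to choose the matrix `B` so that `BAᵗB` is diagonal
> (and its diagonal entries are determined up to multiplication by squares of elements in `K`).»

## What is formalized (matrix form, in Mathlib's conventions `J = Matrix.J (Fin n) K = (0 −1; 1 0)`,
## `Sp = Matrix.symplecticGroup (Fin n) K = {g | g J ᵗg = J}`; multiplier `c`: `ᵗτ J τ = cJ` as in GT §19.1)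

In a symplectic basis adapted to `V = V′ ⊕ V″` (first `n` vectors in `V′`, last `n` in `V″`) an endomorphism
exchanging `V′` and `V″` is block-antidiagonal, `τ = (0 A; C 0)`:

* §1 (any commutative ring) `antidiag_mul_self` (`τ² = (AC 0; 0 CA)`), `transpose_antidiag_mul_J_mul_antidiag`
  (`ᵗτJτ = (0 ᵗCA; −ᵗAC 0)`), `antidiag_involution_multiplier_neg_one` («the matrix of `τ` … is `(0 A; ᵗA⁻¹ 0)`.
  The condition `τ² = I` implies that `A` is symmetric»: `τ² = 1` and `ᵗτJτ = −J` give `AC = CA = 1`, `ᵗA = A`,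
  `ᵗC = C`), `blockDiagonal_mul_antidiag_mul_blockDiagonal` («replacing `A` with `BAᵗB`»:
  `(B 0; 0 ᵗB′)(0 A; C 0)(B′ 0; 0 ᵗB) = (0 BAᵗB; ᵗB′CB′ 0)`), `blockDiagonal_mem_symplecticGroup_of_mul_eq_one`
  (`(B 0; 0 ᵗB′) ∈ Sp` when `B′B = 1`), `blockDiagonal_mul_blockDiagonal_eq_one`;
* §2 (field `K`, `2 ≠ 0`) `exists_mul_mul_transpose_eq_diagonal` («it is possible to choose the matrix `B` so that
  `BAᵗB` is diagonal»: `ᵗA = A`, `det A ≠ 0` ⟹ `∃ B`, `det B ≠ 0`, `BAᵗB = diag(d)`, all `d_i ≠ 0` — from the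
  orthogonal-basis theorem, via the tree's `SpinLift.exists_orthogonal_basis_toBilin'`);
* §3 ★ `exists_blockDiagonal_conj_antidiag_eq` — LEMMA 46 in matrix form: for `τ = (0 A; C 0)` with `τ² = 1` and
  `ᵗτJτ = −J` over a field with `2 ≠ 0` there are `B ∈ GL_n(K)` (with `B′ = B⁻¹`) and `d ∈ (K^×)ⁿ` such that the
  block-diagonal `g = (B 0; 0 ᵗB⁻¹) ∈ Sp_{2n}(K)` (a symplectic change of basis preserving `V′ = Kⁿ × 0` and
  `V″ = 0 × Kⁿ`) satisfies `gτg⁻¹ = (0 diag(d); diag(d)⁻¹ 0)` — i.e. in the new symplectic basis `τ(e′_i) = a_ie″_i`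
  with `a_i = d_i⁻¹ ∈ K^×` (and `τ(e″_i) = d_ie′_i`).

Scope: the coordinate-free sentence (Lagrangian decomposition, «any choice of basis of `V′` determines a dual basis of
`V″`») is taken in coordinates: we start from the block-antidiagonal matrix in an adapted symplectic basis.
THEOREMS ONLY; no definition, instance, notation or named fact.

## References

* [GoreskyTai2017RealStructuresOrdinary] M. Goresky, Y.-S. Tai, *Real structures on ordinary abelian varieties*,
  arXiv:1701.07742 (2017), Appendix §19.3, Lemma 46 (and §19.1 for the multiplier `ᵗτJτ = cJ`).
-/

noncomputable section

open Matrix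

namespace Literature.LinearAlgebra.Matrix

/-! ## §1 Block-antidiagonal involutions of multiplier `−1` and block-diagonal symplectic conjugation -/

section Blocks

variable {R : Type*} [CommRing R] {n : Type*} [Fintype n] [DecidableEq n]

/-- `(0 A; C 0)² = (AC 0; 0 CA)`. [cite: GoreskyTai2017RealStructuresOrdinary, App. §19.3 proof of Lemma 46 («The condition `τ² = I` …»)] -/
theorem antidiag_mul_self (A C : Matrix n n R) :
    fromBlocks 0 A C 0 * fromBlocks 0 A C 0 = fromBlocks (A * C) 0 0 (C * A) := by
  rw [fromBlocks_multiply]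
  simp

/-- The multiplier of `τ = (0 A; C 0)`: `ᵗτJτ = (0 ᵗCA; −ᵗAC 0)` (`J = (0 −1; 1 0)`).
[cite: GoreskyTai2017RealStructuresOrdinary, App. §19.1 («`ᵗτJτ = cJ` … `τ ∈ GSp_{2n}` has multiplier equal to `c`»)] -/
theorem transpose_antidiag_mul_J_mul_antidiag (A C : Matrix n n R) :
    (fromBlocks 0 A C 0)ᵀ * Matrix.J n R * fromBlocks 0 A C 0 = fromBlocks 0 (Cᵀ * A) (-(Aᵀ * C)) 0 := by
  rw [Matrix.J, fromBlocks_transpose, fromBlocks_multiply, fromBlocks_multiply]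
  simp

/-- **«The matrix of `τ` … is `(0 A; ᵗA⁻¹ 0)`.  The condition `τ² = I` implies that `A` is symmetric»**: for
`τ = (0 A; C 0)` with `τ² = 1` and multiplier `−1` (`ᵗτJτ = −J`) one has `AC = CA = 1` (so `C = A⁻¹`), `ᵗA = A`
and `ᵗC = C` (so `C = ᵗA⁻¹`). [cite: GoreskyTai2017RealStructuresOrdinary, App. §19.3 proof of Lemma 46] -/
theorem antidiag_involution_multiplier_neg_one (A C : Matrix n n R)
    (h1 : fromBlocks 0 A C 0 * fromBlocks 0 A C 0 = 1)
    (hJ : (fromBlocks 0 A C 0)ᵀ * Matrix.J n R * fromBlocks 0 A C 0 = -Matrix.J n R) :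
    A * C = 1 ∧ C * A = 1 ∧ Aᵀ = A ∧ Cᵀ = C := by
  rw [antidiag_mul_self, ← fromBlocks_one, fromBlocks_inj] at h1
  obtain ⟨hAC, -, -, hCA⟩ := h1
  rw [transpose_antidiag_mul_J_mul_antidiag, Matrix.J, fromBlocks_neg, fromBlocks_inj, neg_neg] at hJ
  obtain ⟨-, hCtA, -, -⟩ := hJ
  have hC : Cᵀ = C := by
    calc Cᵀ = Cᵀ * (A * C) := by rw [hAC, Matrix.mul_one]
      _ = Cᵀ * A * C := by rw [Matrix.mul_assoc]
      _ = C := by rw [hCtA, Matrix.one_mul]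
  have hA : Aᵀ = A := by
    calc Aᵀ = Aᵀ * (C * A) := by rw [hCA, Matrix.mul_one]
      _ = Aᵀ * Cᵀ * A := by rw [hC, Matrix.mul_assoc]
      _ = (C * A)ᵀ * A := by rw [transpose_mul]
      _ = A := by rw [hCA, transpose_one, Matrix.one_mul]
  exact ⟨hAC, hCA, hA, hC⟩

/-- **«This has the effect of changing the matrix of `τ` by replacing `A` with `BAᵗB`»**: conjugating
`(0 A; C 0)` by the block-diagonal `g = (B 0; 0 ᵗB′)`, `g⁻¹ = (B′ 0; 0 ᵗB)` (`B′ = B⁻¹`), gives `(0 BAᵗB; ᵗB′CB′ 0)`.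
[cite: GoreskyTai2017RealStructuresOrdinary, App. §19.3 proof of Lemma 46] -/
theorem blockDiagonal_mul_antidiag_mul_blockDiagonal (A C B B' : Matrix n n R) :
    fromBlocks B 0 0 B'ᵀ * fromBlocks 0 A C 0 * fromBlocks B' 0 0 Bᵀ =
      fromBlocks 0 (B * A * Bᵀ) (B'ᵀ * C * B') 0 := by
  rw [fromBlocks_multiply, fromBlocks_multiply]
  simp [Matrix.mul_assoc]

/-- **`g = (B 0; 0 ᵗB⁻¹)` is «a symplectic change of basis that preserves the decomposition `Kⁿ ⊕ Kⁿ`»**: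
`(B 0; 0 ᵗB′) ∈ Sp_{2n}` whenever `B′B = 1`. [cite: GoreskyTai2017RealStructuresOrdinary, App. §19.3 proof of Lemma 46] -/
theorem blockDiagonal_mem_symplecticGroup_of_mul_eq_one {B B' : Matrix n n R} (h : B' * B = 1) :
    fromBlocks B 0 0 B'ᵀ ∈ Matrix.symplecticGroup n R := by
  have ht : Bᵀ * B'ᵀ = 1 := by rw [← transpose_mul, h, transpose_one]
  rw [SymplecticGroup.fromBlocks_mem_iff, ht]
  refine ⟨by simp, by simp, by simp⟩

/-- `(B 0; 0 ᵗB′)(B′ 0; 0 ᵗB) = 1` when `BB′ = 1` (so the second matrix is `g⁻¹`).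
[cite: GoreskyTai2017RealStructuresOrdinary, App. §19.3 proof of Lemma 46] -/
theorem blockDiagonal_mul_blockDiagonal_eq_one {B B' : Matrix n n R} (h : B * B' = 1) :
    fromBlocks B 0 0 B'ᵀ * fromBlocks B' 0 0 Bᵀ = 1 := by
  rw [fromBlocks_multiply, ← transpose_mul, h, transpose_one, ← fromBlocks_one]
  simp

end Blocks

/-! ## §2 Congruence diagonalisation of an invertible symmetric matrix (`2 ≠ 0`) -/

section Diagonal

variable {K : Type*} [Field K]

/-- **«It is possible to choose the matrix `B` so that `BAᵗB` is diagonal»**: over a field with `2 ≠ 0`, an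
invertible symmetric `A` is congruent to an invertible diagonal matrix: `∃ B ∈ GL_n(K)`, `BAᵗB = diag(d)`,
`d_i ≠ 0` (the rows of `B` are an orthogonal basis of anisotropic vectors for `ᵗxAy`).
[cite: GoreskyTai2017RealStructuresOrdinary, App. §19.3 proof of Lemma 46] -/
theorem exists_mul_mul_transpose_eq_diagonal (h2 : (2 : K) ≠ 0) {m : ℕ} (A : Matrix (Fin m) (Fin m) K)
    (hA : Aᵀ = A) (hdet : A.det ≠ 0) :
    ∃ B : Matrix (Fin m) (Fin m) K, B.det ≠ 0 ∧ ∃ d : Fin m → K, (∀ i, d i ≠ 0) ∧ B * A * Bᵀ = diagonal d := by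
  haveI : Invertible (2 : K) := invertibleOfNonzero h2
  obtain ⟨b, hbo, hba⟩ :=
    Literature.NumberTheory.GaloisRepresentations.SpinLift.exists_orthogonal_basis_toBilin' A hA hdet
  set B : Matrix (Fin m) (Fin m) K := Matrix.of fun i a => b i a with hB
  have key : ∀ i j, (B * A * Bᵀ) i j = Matrix.toBilin' A (b i) (b j) := by
    intro i j
    simp only [Matrix.mul_apply, Matrix.transpose_apply, hB, Matrix.of_apply, Matrix.toBilin'_apply,
      Finset.sum_mul]
    rw [Finset.sum_comm]
  refine ⟨B, ?_, fun i => Matrix.toBilin' A (b i) (b i), hba, ?_⟩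
  · have hBt : Bᵀ = (Pi.basisFun K (Fin m)).toMatrix b := by
      ext i j
      rw [transpose_apply, hB, of_apply, Module.Basis.toMatrix_apply, Pi.basisFun_repr]
    have hu : IsUnit Bᵀ.det := by
      rw [hBt, ← Module.Basis.det_apply]
      exact (Pi.basisFun K (Fin m)).isUnit_det b
    rw [det_transpose] at hu
    exact hu.ne_zero
  · ext i j
    rw [key]
    by_cases hij : i = j
    · subst hij
      rw [diagonal_apply_eq]
    · rw [diagonal_apply_ne _ hij]
      exact LinearMap.isOrthoᵢ_def.1 hbo i j hij

end Diagonal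

/-! ## §3 Lemma 46 in matrix form -/

section Lemma46

variable {K : Type*} [Field K]

/-- **Goresky–Tai 2017, Lemma 46 (matrix form).**  Let `K` be a field with `2 ≠ 0` and let `τ = (0 A; C 0)` be the
matrix, in a symplectic basis adapted to a Lagrangian decomposition `V = V′ ⊕ V″`, of an involution (`τ² = 1`) of
multiplier `−1` (`ᵗτJτ = −J`) exchanging `V′` and `V″`.  Then there are `B ∈ GL_n(K)` (`B′ = B⁻¹`: `B′B = BB′ = 1`)
and units `d_1, …, d_n ∈ K^×` such that the block-diagonal symplectic change of basis `g = (B 0; 0 ᵗB⁻¹) ∈ Sp_{2n}(K)`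
(preserving `V′` and `V″`; `g⁻¹ = (B′ 0; 0 ᵗB)`) conjugates `τ` to `gτg⁻¹ = (0 diag(d); diag(d)⁻¹ 0)`: in the new
symplectic basis `e′_i = g⁻¹e_i`, `e″_i = g⁻¹e_{n+i}` one has «`τ(e′_i) = a_ie″_i`» with `a_i = d_i⁻¹ ∈ K^×`.
[cite: GoreskyTai2017RealStructuresOrdinary, App. §19.3 Lemma 46] -/
theorem exists_blockDiagonal_conj_antidiag_eq (h2 : (2 : K) ≠ 0) {m : ℕ} (A C : Matrix (Fin m) (Fin m) K)
    (h1 : fromBlocks 0 A C 0 * fromBlocks 0 A C 0 = 1)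
    (hJ : (fromBlocks 0 A C 0)ᵀ * Matrix.J (Fin m) K * fromBlocks 0 A C 0 = -Matrix.J (Fin m) K) :
    ∃ B B' : Matrix (Fin m) (Fin m) K, B' * B = 1 ∧ B * B' = 1 ∧
      fromBlocks B 0 0 B'ᵀ ∈ Matrix.symplecticGroup (Fin m) K ∧
      fromBlocks B 0 0 B'ᵀ * fromBlocks B' 0 0 Bᵀ = 1 ∧
      ∃ d : Fin m → K, (∀ i, d i ≠ 0) ∧
        fromBlocks B 0 0 B'ᵀ * fromBlocks 0 A C 0 * fromBlocks B' 0 0 Bᵀ =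
          fromBlocks 0 (diagonal d) (diagonal fun i => (d i)⁻¹) 0 := by
  obtain ⟨hAC, -, hA, -⟩ := antidiag_involution_multiplier_neg_one A C h1 hJ
  have hdet : A.det ≠ 0 := by
    intro h0
    have h := congrArg det hAC
    rw [det_mul, h0, zero_mul, det_one] at h
    exact zero_ne_one h
  obtain ⟨B, hB, d, hd, hBAB⟩ := exists_mul_mul_transpose_eq_diagonal h2 A hA hdet
  have hBu : IsUnit B.det := isUnit_iff_ne_zero.2 hB
  refine ⟨B, B⁻¹, B.nonsing_inv_mul hBu, B.mul_nonsing_inv hBu,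
    blockDiagonal_mem_symplecticGroup_of_mul_eq_one (B.nonsing_inv_mul hBu),
    blockDiagonal_mul_blockDiagonal_eq_one (B.mul_nonsing_inv hBu), d, hd, ?_⟩
  rw [blockDiagonal_mul_antidiag_mul_blockDiagonal, hBAB]
  have ht : Bᵀ * (B⁻¹)ᵀ = 1 := by rw [← transpose_mul, B.nonsing_inv_mul hBu, transpose_one]
  have hX : diagonal d * ((B⁻¹)ᵀ * C * B⁻¹) = 1 := by
    rw [← hBAB]
    calc B * A * Bᵀ * ((B⁻¹)ᵀ * C * B⁻¹) = B * A * (Bᵀ * (B⁻¹)ᵀ) * C * B⁻¹ := by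
          simp only [Matrix.mul_assoc]
      _ = 1 := by rw [ht, Matrix.mul_one, Matrix.mul_assoc B, hAC, Matrix.mul_one, B.mul_nonsing_inv hBu]
  have hdiag : (diagonal fun i => (d i)⁻¹) * diagonal d = 1 := by
    rw [diagonal_mul_diagonal, ← diagonal_one]
    congr 1
    funext i
    exact inv_mul_cancel₀ (hd i)
  have hC : (B⁻¹)ᵀ * C * B⁻¹ = diagonal fun i => (d i)⁻¹ := by
    calc (B⁻¹)ᵀ * C * B⁻¹ = (diagonal fun i => (d i)⁻¹) * diagonal d * ((B⁻¹)ᵀ * C * B⁻¹) := by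
          rw [hdiag, Matrix.one_mul]
      _ = (diagonal fun i => (d i)⁻¹) * (diagonal d * ((B⁻¹)ᵀ * C * B⁻¹)) := by rw [Matrix.mul_assoc]
      _ = diagonal fun i => (d i)⁻¹ := by rw [hX, Matrix.mul_one]
  rw [hC]

end Lemma46

end Literature.LinearAlgebra.Matrix
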